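import Literature.NumberTheory.Transcendental.AnalytificationChartsProofs
import Literature.NumberTheory.Transcendental.AnalytificationSeparatedProofs
import HarnessLib

/-!
# Existence of the analytification of a smooth separated scheme (proof file)

This file discharges the named fact `Literature.NumberTheory.Transcendental.exists_isAnalytification` of
`Literature.NumberTheory.Transcendental.Analytification` (`Literature.NumberTheory.Transcendental.exists_isAnalytification_holds`):
a smooth separated `k`-scheme `X` (`k ⊆ ℂ`) of relative dimension `d`, locally of finite type,
has an analytification — a Hausdorff complex manifold `M` modelled on `ℂᵈ` with a holomorphic
atlas and `φ : M → X(ℂ)` with `IsAnalytification (Fin d → ℂ) X d φ`. Following Serre (GAGA §2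
n°5 Prop. 2, n°6 Prop. 3 Cor. 2) one takes `M := X(ℂ)` with its strong topology and `φ := id`:

* `X(ℂ)` is Hausdorff for `X` separated over `k` — `Literature.NumberTheory.Transcendental.t2Space_algPoints_holds`
  (`AnalytificationSeparatedProofs`; Serre: the graphs of the identifications between affine
  charts are Zariski closed);
* every point lies in a holomorphic algebraic chart — `Literature.NumberTheory.Transcendental.exists_algebraicChart_holds`
  (`AnalytificationChartsProofs`: standard smooth affine neighbourhoods, coordinates embed
  `V(ℂ)` onto the zero set of the presentation, holomorphic implicit function theorem, regular
  functions are locally quotients of polynomials in the chart; Serre's Lemme 1 and §1 n°4);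
* such charts form a holomorphic atlas in which regular functions are holomorphic —
  `Literature.NumberTheory.Transcendental.exists_isAnalytification_of_exists_algebraicChart` (`AnalytificationCharts`).

## References

* J.-P. Serre, *Géométrie algébrique et géométrie analytique*, Ann. Inst. Fourier **6** (1956),
  §2 n°5 Prop. 2, n°6 Prop. 3 and Cor. 2.
* A. Grothendieck, M. Raynaud, *SGA 1*, Exposé XII, Thm. 1.1.
-/

namespace Literature.NumberTheory.Transcendental

/-- **Existence of the analytification (discharge of `Literature.NumberTheory.Transcendental.exists_isAnalytification`).** A smooth
separated `k`-scheme `X` (`k ⊆ ℂ`) of relative dimension `d`, locally of finite type, has an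
analytification: `M := X(ℂ)` with the strong topology is Hausdorff (`Literature.NumberTheory.Transcendental.t2Space_algPoints_holds`,
`X` separated) and the holomorphic algebraic charts of `Literature.NumberTheory.Transcendental.exists_algebraicChart_holds` form a
holomorphic atlas modelled on `ℂᵈ` in which regular functions are holomorphic
(`Literature.NumberTheory.Transcendental.exists_isAnalytification_of_exists_algebraicChart`), so that `id : M → X(ℂ)` is an
`IsAnalytification`. [Serre, GAGA §2 n°5 Prop. 2, n°6 Prop. 3 Cor. 2; SGA1 XII Thm. 1.1]
[cite: SerreGAGA1956, §2 n°5 Prop. 2 and n°6 Prop. 3 Cor. 2] -/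
theorem exists_isAnalytification_holds {k : Type} [Field k] [Algebra k ℂ] (X : Literature.AlgebraicGeometry.Motives.SchemeOver k)
    (d : ℕ) : exists_isAnalytification X d :=
  exists_isAnalytification_of_exists_algebraicChart (t2Space_algPoints_holds X ℂ)
    (exists_algebraicChart_holds X d)

end Literature.NumberTheory.Transcendental
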